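import Literature.AnabelianGeometry.AbsoluteAnabelian.AbsAnabFundamentalGroupsSchemaNegative
import Literature.AnabelianGeometry.AbsoluteAnabelian.AbsAnabLemma114Holds
import Literature.AnabelianGeometry.AbsoluteAnabelian.AbsTopIProp23InfiniteIndexProofs
import Literature.AnabelianGeometry.AbsoluteAnabelian.NFGaloisTFGNormalCorollaries
import HarnessLib

/-!
# [AbsAnab] Lemmas 1.3.1, 1.1.4 (i)/(ii), 1.3.7: CLOSED kernel instances of the predicates
# `GeomAndArithSlim`, `GeomIsMaxTFGNormalIn`, `CoinvariantRankConstant`,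
# `CuspidalData.InertiaCommensurablyTerminal` (FACT-LIST F-0004 / F-0005 / F-0001 / F-0003)
# at the arithmetic extensions `G_ℚ ⟶ G_ℚ` and `G_{ℚ₂} ⟶ G_{ℚ₂}`

S. Mochizuki, *The Absolute Anabelian Geometry of Hyperbolic Curves*, in: Galois Theory and Modular
Forms, Kluwer (2004) [MochizukiAbsAnab2004] (manuscript pagination, lit key `paper:url-e8f118cc205e`):
Lemma 1.3.1 p. 15, Lemma 1.1.4 (i) p. 7 / (ii) pp. 7–8, Lemma 1.3.7 p. 18.

PROOF-ONLY (no definition, no instance) third companion — after `AbsAnabFundamentalGroupsModelProofs`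
(instance forms at the surface-group model) and `AbsAnabGeomPredicatesSchemaNegative` (universal
closures refuted) — of abc-iut-L4-t4's `AbsAnabFundamentalGroups.lean`, abc-iut cell, block F seat
abc-iut-f-051.  The model theorems and the abstract instance forms (`NFBase.geomAndArithSlim`,
`geomIsMaxTFGNormalIn_of_nfBase`, `coinvariantRankConstant_of_mlfBase`) all carry `Prop` hypotheses
(a presentation of `Δ`, (∗), a splitting); a kernel census therefore sees the four rows as
CONDITIONAL only.  This file records, for each row, ONE CLOSED THEOREM — no hypotheses at all — at a
genuinely arithmetic (if geometrically degenerate, `Δ = 1`) instance built from Mathlib's absolute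
Galois groups, so that each predicate is kernel-witnessed SATISFIABLE at an instance carrying the
printed base-field data (`NFBase` / `MLFBase`):

* **F-0004** `geomAndArithSlim_absoluteGalois_rat` — `Π = G = G_ℚ`, `aug = id`: `Δ = 1` is slim and
  `Π = G_ℚ` is slim — the content is [AbsAnab] Thm 1.1.1 (ii) for `ℚ` (`galoisNF_slim_holds`, through
  `NFBase.geomAndArithSlim`);
* **F-0005** `geomIsMaxTFGNormalIn_absoluteGalois_rat` (every open `Π′`) and the closed
  `geomIsMaxTFGNormalIn_top_absoluteGalois_rat` (`Π′ = Π`) — same extension: "`Δ ∩ Π′ = 1` is the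
  maximal topologically finitely generated closed normal subgroup of `Π′ ⊆ G_ℚ` open", i.e. EXACTLY
  [AbsAnab] Thm 1.1.2 ([FJ] 15.10) for the number fields `F′/ℚ` (`galoisNF_tfgNormalSubgroup_trivial_holds`
  through `geomIsMaxTFGNormalIn_of_nfBase`);
* **F-0001** `coinvariantRankConstant_absoluteGalois_padicTwo` — `Π = G = G_{ℚ₂}`, `aug = id`, MLF
  base data `(2, ℚ₂, refl)`: the extension splits (identity section) and satisfies (∗) with `m = 0`
  (abc-iut-f-053's `splitsOverOpenSubgroup_of_section`, `starCondition_of_geom_eq_bot`), so the p. 8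
  derivation `coinvariantRankConstant_of_mlfBase` applies: `δ¹_l(Π′) − δ¹_l(G′)` is independent of `l`;
* **F-0003** `inertiaCommensurablyTerminal_absoluteGalois_rat` — on `G_ℚ ⟶ G_ℚ` the cuspidal datum with
  one cusp, `D_x = Π`, `I_x = D_x ∩ Δ = Δ`: `I_x = Δ` is (trivially) commensurably terminal in `Δ`.
  Recorded as the DEGENERATE closed witness it is (the non-degenerate instance form is the model theorem
  `CuspidalData.inertiaCommensurablyTerminal_of_isProSigmaCompletion`).

HONEST SCOPE: closed satisfiability witnesses with the printed base fields, `Δ` trivial (no étale `π₁`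
of a curve is constructed in the tree); FACT-LIST class of the four rows stays «universal-closure
REFUTED; instance form PROVED»; nothing here bears on [IUTchIII] Cor. 3.12 or takes a side.
-/

noncomputable section

namespace Literature.AnabelianGeometry.AbsoluteAnabelian.FundamentalExtension

open Literature.AlgebraicGeometry.Frobenioids (IsSlimGroup)
open scoped Pointwise

/-! ### The split extension `A ⟶ A` with `Δ = 1` -/

/-- For the extension `id : A ⟶ A` the geometric subgroup `Δ = Ker(id)` is trivial. [folklore] -/
private theorem geom_id_eq_bot (A : ProfiniteGrp.{0}) :
    (⟨A, A, ContinuousMonoidHom.id _, Function.surjective_id⟩ : FundamentalExtension.{0}).geom = ⊥ := by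
  ext x
  exact ⟨fun h => Subgroup.mem_bot.mpr ((mem_geom _).mp h), fun h => (mem_geom _).mpr (Subgroup.mem_bot.mp h)⟩

/-- A trivial topological group is slim (every centraliser is the trivial group). [folklore] -/
private theorem isSlimGroup_of_subsingleton {G : Type*} [Group G] [TopologicalSpace G]
    [Subsingleton G] : IsSlimGroup G :=
  ⟨fun H _ => by
    rw [eq_bot_iff]
    intro x _
    exact Subgroup.mem_bot.mpr (Subsingleton.elim x 1)⟩

/-- For `id : A ⟶ A`, `Δ = 1` is slim. [folklore] -/
private theorem isSlimGroup_geom_id (A : ProfiniteGrp.{0}) :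
    IsSlimGroup (⟨A, A, ContinuousMonoidHom.id _, Function.surjective_id⟩ : FundamentalExtension.{0}).geom := by
  rw [geom_id_eq_bot]
  exact isSlimGroup_of_subsingleton

/-- For `id : A ⟶ A`, `Δ = 1` is topologically finitely generated. [folklore] -/
private theorem isTopologicallyFinitelyGenerated_geom_id (A : ProfiniteGrp.{0}) :
    IsTopologicallyFinitelyGenerated
      (⟨A, A, ContinuousMonoidHom.id _, Function.surjective_id⟩ : FundamentalExtension.{0}).geom := by
  rw [geom_id_eq_bot]
  exact isTopologicallyFinitelyGenerated_of_finite

/-! ### F-0004 at `G_ℚ ⟶ G_ℚ` -/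

/-- **F-0004, closed instance** ([AbsAnab] Lemma 1.3.1 at the degenerate arithmetic extension
`Π = G = G_ℚ`, `aug = id`, NF base data `(ℚ, refl)`): `Δ = 1` and `Π = G_ℚ` are slim — the `Π`-half
being the slimness of `G_ℚ` ([AbsAnab] Thm 1.1.1 (ii), `galoisNF_slim_holds`).
[cite: MochizukiAbsAnab2004, Lemma 1.3.1 p.15] -/
theorem geomAndArithSlim_absoluteGalois_rat :
    (⟨absoluteGaloisGrp ℚ, absoluteGaloisGrp ℚ, ContinuousMonoidHom.id _, Function.surjective_id⟩ :
      FundamentalExtension.{0}).GeomAndArithSlim :=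
  NFBase.geomAndArithSlim { F := ℚ, galIso := ContinuousMulEquiv.refl _ }
    (isSlimGroup_geom_id (absoluteGaloisGrp ℚ))

/-! ### F-0005 at `G_ℚ ⟶ G_ℚ` -/

/-- **F-0005 at `Π = G = G_ℚ`, every open `Π′`** ([AbsAnab] Lemma 1.1.4 (i) at the degenerate
arithmetic extension; its content is exactly Thm 1.1.2: an open `Π′ ⊆ G_ℚ` is `G_{F′}` for a number
field `F′`, and every topologically finitely generated closed normal subgroup of `G_{F′}` is trivial,
i.e. `⊆ Δ ∩ Π′ = 1`). [cite: MochizukiAbsAnab2004, Lemma 1.1.4 (i) p.7] -/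
theorem geomIsMaxTFGNormalIn_absoluteGalois_rat
    (P : Subgroup (⟨absoluteGaloisGrp ℚ, absoluteGaloisGrp ℚ, ContinuousMonoidHom.id _,
      Function.surjective_id⟩ : FundamentalExtension.{0}).arith)
    (hP : IsOpen (P : Set (absoluteGaloisGrp ℚ))) :
    (⟨absoluteGaloisGrp ℚ, absoluteGaloisGrp ℚ, ContinuousMonoidHom.id _, Function.surjective_id⟩ :
      FundamentalExtension.{0}).GeomIsMaxTFGNormalIn P :=
  geomIsMaxTFGNormalIn_of_nfBase _ { F := ℚ, galIso := ContinuousMulEquiv.refl _ }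
    (isTopologicallyFinitelyGenerated_geom_id (absoluteGaloisGrp ℚ)) P hP

/-- **F-0005, closed instance** (`Π′ = Π = G = G_ℚ`): `Δ = 1` is the maximal topologically finitely
generated closed normal subgroup of `G_ℚ` — [AbsAnab] Thm 1.1.2 for `ℚ` in the shape of the
predicate the [AbsTopI] Thm 2.14 / [AbsTopII] Rmk 3.3.2 consumers bind.
[cite: MochizukiAbsAnab2004, Lemma 1.1.4 (i) p.7] -/
theorem geomIsMaxTFGNormalIn_top_absoluteGalois_rat :
    (⟨absoluteGaloisGrp ℚ, absoluteGaloisGrp ℚ, ContinuousMonoidHom.id _, Function.surjective_id⟩ :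
      FundamentalExtension.{0}).GeomIsMaxTFGNormalIn ⊤ :=
  geomIsMaxTFGNormalIn_absoluteGalois_rat ⊤ isOpen_univ

/-! ### F-0001 at `G_{ℚ₂} ⟶ G_{ℚ₂}` -/

/-- **F-0001, closed instance** (the p. 8 step of [AbsAnab] Lemma 1.1.4 (ii) at the degenerate
arithmetic extension `Π = G = G_{ℚ₂}`, `aug = id`, MLF base data `(2, ℚ₂, refl)`): the extension
splits (identity section) and satisfies (∗) (with `m = 0`, `Δ'' = 1`), hence
`δ¹_l(Π′) − δ¹_l(G′)` does not depend on `l` (`coinvariantRankConstant_of_mlfBase`).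
[cite: MochizukiAbsAnab2004, proof of Lemma 1.1.4 (ii) p.8] -/
theorem coinvariantRankConstant_absoluteGalois_padicTwo :
    (⟨absoluteGaloisGrp ℚ_[2], absoluteGaloisGrp ℚ_[2], ContinuousMonoidHom.id _,
      Function.surjective_id⟩ : FundamentalExtension.{0}).CoinvariantRankConstant :=
  coinvariantRankConstant_of_mlfBase _ { p := 2, K := ℚ_[2], galIso := ContinuousMulEquiv.refl _ }
    (splitsOverOpenSubgroup_of_section _ (ContinuousMonoidHom.id _) fun _ => rfl)
    (starCondition_of_geom_eq_bot _ (geom_id_eq_bot (absoluteGaloisGrp ℚ_[2])))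

/-! ### F-0003 at `G_ℚ ⟶ G_ℚ` (degenerate) -/

/-- **F-0003, closed (degenerate) instance**: on `Π = G = G_ℚ`, `aug = id`, the cuspidal datum with
ONE cusp, decomposition group `D_x = Π` and inertia group `I_x = D_x ∩ Δ = Δ (= 1)` has `I_x`
commensurably terminal in `Δ` (`I_x = Δ`).  A satisfiability witness only — the geometric instance
form is `CuspidalData.inertiaCommensurablyTerminal_of_isProSigmaCompletion`.
[cite: MochizukiAbsAnab2004, Lemma 1.3.7 p.18] -/
theorem inertiaCommensurablyTerminal_absoluteGalois_rat :
    ({ Cusp := PUnit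
       Dcusp := fun _ => ⊤
       Icusp := fun _ => ⊤ ⊓ FundamentalExtension.geom _
       Icusp_eq := fun _ => rfl
       isClosed_Dcusp := fun _ => isClosed_univ
       eq_of_conj := fun x y _ _ => Subsingleton.elim x y } :
      CuspidalData (⟨absoluteGaloisGrp ℚ, absoluteGaloisGrp ℚ, ContinuousMonoidHom.id _,
        Function.surjective_id⟩ : FundamentalExtension.{0})).InertiaCommensurablyTerminal := by
  intro x
  -- `I_x = ⊤ ⊓ Δ`, viewed inside `Δ`, is all of `Δ`
  have htop : ((⊤ ⊓ FundamentalExtension.geom _ : Subgroup _).subgroupOf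
      (⟨absoluteGaloisGrp ℚ, absoluteGaloisGrp ℚ, ContinuousMonoidHom.id _,
        Function.surjective_id⟩ : FundamentalExtension.{0}).geom) = ⊤ := by
    rw [top_inf_eq, Subgroup.subgroupOf_self]
  change IsCommensurablyTerminal ((⊤ ⊓ FundamentalExtension.geom _ : Subgroup _).subgroupOf _)
  rw [htop]
  refine ⟨eq_top_iff.mpr fun g _ => ?_⟩
  rw [Subgroup.Commensurable.commensurator_mem_iff]
  have h1 : ConjAct.toConjAct g •
      (⊤ : Subgroup (⟨absoluteGaloisGrp ℚ, absoluteGaloisGrp ℚ, ContinuousMonoidHom.id _,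
        Function.surjective_id⟩ : FundamentalExtension.{0}).geom) = ⊤ :=
    top_le_iff.mp fun y _ => Subgroup.mem_pointwise_smul_iff_inv_smul_mem.mpr (Subgroup.mem_top _)
  rw [h1]
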